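import Summits.FinalStateConjecture.FinalStateConjecture.Theorems.ZeroEnergyKerrOrBombErgoregionBombModTLightPointTransport

/-!
# `ErgoregionBombModT` — every Killing light point of the d.o.c. inhabits the antecedent
# (crux stmt-FinalStateConjecture-17838, line `killing-light-points`, lead c2)

Companion of `…LightPointTransport.lean` (transport of the light-point condition along the orbit;
the hovering species).  Here the INCOMPLETE species and the consequences:

* `hasZeroEnergyRayTrappedModFlow_of_incompleteLightPoint` — for `p ∈ ⟨⟨M_ext⟩⟩` with
  `g(T,T)(p) = 0`, `∇_T T = κ T`, `κ ≠ 0`: `γ(s) := σ(log(κ s)/κ)` (`σ` the orbit through `p`)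
  is an affinely parametrised zero-energy null geodesic on the half-line `{0 < κ s}`, trapped in
  the orbit of `{p}`, and MAXIMAL: an extension through `s = 0` would force `σ(τ)` to converge, as
  `κτ → -∞`, to a zero `q` of `T` (`T(q) = lim (κ s) γ̇(s) = 0`), so `q ∈ 𝓔⁺ ⊆ U` and the orbit
  would carry `κ`-light points into the collar, where the timelike commuting Killing field `K`
  forbids them (`leviCivita_self_ne_smul_of_collar`, p136504) — Hawking–Ellis §9.3 p. 331 (after
  Hájíček 1973): incomplete null Killing orbits of the stationary limit surface end at zeros of the
  Killing field.  So stub W1 (`stub_noBeltIncompleteLightPoints`) cannot be dropped from any proof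
  of the crux AS TYPED, and is exactly what a restate adding `s = Set.univ` deletes;
* `hasZeroEnergyRayTrappedModFlow_of_lightPoint` — both species;
* `incompleteLightPoint_inhabits_antecedent` — the registered closed form; the consequences
  (`noDocLightPoints_of_nonTrapping`, the lossless split) are in `…LightPointSplit.lean`.

References: S. W. Hawking, G. F. R. Ellis (1973), §9.3 p. 331; P. Hájíček, Phys. Rev. D 7 (1973)
2311; B. O'Neill (1983), Ch. 3 Prop. 3.18, Def. 3.19, p. 68; A. D. Ionescu, S. Klainerman (2015),
§4; crux workfile `Cruxes/ErgoregionBombModT/Lines/killing_light_points.lean`.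
-/

noncomputable section

open Bundle Set Filter Function
open scoped Manifold Topology

-- summit = problem name (D-0017)
set_option linter.dupNamespace false

namespace Summit.FinalStateConjecture.FinalStateConjecture.Theorems.ErgoregionBombModT

open Literature.Geometry.Lorentzian

/-! ### The incomplete species: `κ ≠ 0` -/

section Incomplete

variable {𝓑 : StationaryAFBlackHole.{0}} [𝓑.metric.HasLeviCivita]

/-- The affine parameter of a `κ`-light line: `s ↦ log(κ s)/κ` has derivative `(κ s)⁻¹` at every
`s ≠ 0`. [folklore] -/
theorem hasDerivAt_log_mul_div {κ s : ℝ} (hκ : κ ≠ 0) (hs : s ≠ 0) :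
    HasDerivAt (fun s ↦ Real.log (κ * s) / κ) (κ * s)⁻¹ s := by
  have h1 : HasDerivAt (fun s ↦ κ * s) κ s := by
    simpa using (hasDerivAt_id s).const_mul κ
  have h2 : HasDerivAt (fun s ↦ Real.log (κ * s)) (κ / (κ * s)) s := h1.log (mul_ne_zero hκ hs)
  refine (h2.div_const κ).congr_deriv ?_
  rw [div_right_comm, div_self hκ, one_div]

/-- The coefficient `s ↦ (κ s)⁻¹` has derivative `-κ/(κ s)²` at `s ≠ 0`. [folklore] -/
theorem hasDerivAt_inv_mul {κ s : ℝ} (hκ : κ ≠ 0) (hs : s ≠ 0) :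
    HasDerivAt (fun s ↦ (κ * s)⁻¹) (-κ / (κ * s) ^ 2) s := by
  have h1 : HasDerivAt (fun s ↦ κ * s) κ s := by
    simpa using (hasDerivAt_id s).const_mul κ
  exact h1.inv (mul_ne_zero hκ hs)

/-- **An incomplete Killing light point of the d.o.c. inhabits the antecedent of the crux.**
In the telescope of `ErgoregionBombModT` (clauses used: every event lies in `I⁺(M_ext)`; `T ≠ 0`
on `⟨⟨M_ext⟩⟩`; the collar `U ⊇ 𝓔⁺` is open and carries `K`, smooth, Killing and commuting with
`T` on `U`, timelike on `U ∩ ⟨⟨M_ext⟩⟩`), let `p ∈ ⟨⟨M_ext⟩⟩` satisfy `g(T,T)(p) = 0` and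
`∇_T T = κ T` at `p` with `κ ≠ 0`.  Then `𝓑.HasZeroEnergyRayTrappedModFlow`: the orbit `σ`
through `p` consists of `κ`-light points, `γ(s) := σ(log(κ s)/κ)` is a zero-energy null geodesic
on `{s | 0 < κ s}` (`γ̇ = (κ s)⁻¹ T`, `D γ̇/ds = (-κ/(κs)² + κ/(κs)²) T = 0`) inside the orbit of
`{p}`, and it is MAXIMAL: an extension through `s = 0` would make `σ(τ)` converge as `κτ → -∞` to
a point `q` with `T(q) = lim (κ s) γ̇(s) = 0`, hence `q ∉ ⟨⟨M_ext⟩⟩`,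
`q ∈ ∂I⁻(M_ext) ∩ I⁺(M_ext) = 𝓔⁺ ⊆ U`, and the orbit would carry `κ`-light points into
`U ∩ ⟨⟨M_ext⟩⟩`, where `K` forbids them (`leviCivita_self_ne_smul_of_collar`, p136504).
Hawking–Ellis 1973, §9.3 p. 331 (after Hájíček 1973): incomplete null Killing orbits of the
stationary limit surface end at zeros of `K`. [cite: HawkingEllis1973, §9.3 p. 331] -/
theorem hasZeroEnergyRayTrappedModFlow_of_incompleteLightPoint
    (hpres : ∀ p : 𝓑.carrier, p ∈ 𝓑.metric.chronologicalFuture 𝓑.timeOrientation 𝓑.Mext)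
    (hT0 : ∀ p ∈ 𝓑.doc, 𝓑.killing p ≠ 0) {U : Set 𝓑.carrier}
    {K : Π x : 𝓑.carrier, TangentSpace (𝓡 4) x} (hU : IsOpen U) (hHU : 𝓑.horizon ⊆ U)
    (hKs : ContMDiffOn (𝓡 4) ((𝓡 4).prod 𝓘(ℝ, E4)) ((⊤ : ℕ∞) : WithTop ℕ∞)
      (fun x ↦ (TotalSpace.mk' E4 x (K x) : TangentBundle (𝓡 4) 𝓑.carrier)) U)
    (hKill : ∀ x ∈ U, ∀ v w : TangentSpace (𝓡 4) x,
      𝓑.metric.val x (𝓑.metric.leviCivita K x v) w + 𝓑.metric.val x v (𝓑.metric.leviCivita K x w) = 0)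
    (hcomm : ∀ x ∈ U, VectorField.mlieBracket (𝓡 4) 𝓑.killing K x = 0)
    (hKtime : ∀ x ∈ U ∩ 𝓑.doc, 𝓑.metric.val x (K x) (K x) < 0)
    {p : 𝓑.carrier} (hp : p ∈ 𝓑.doc) (hlam : 𝓑.metric.val p (𝓑.killing p) (𝓑.killing p) = 0)
    {κ : ℝ} (hκ : κ ≠ 0)
    (hacc : 𝓑.metric.leviCivita 𝓑.killing p (𝓑.killing p) = κ • 𝓑.killing p) :
    𝓑.HasZeroEnergyRayTrappedModFlow := by
  set cov := 𝓑.metric.toPseudoRiemannianMetric.leviCivita with hcov_def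
  -- the orbit through `p` and the transported light-point data
  obtain ⟨σ, hσ, hσ0⟩ := 𝓑.isStationaryKilling.isCompleteVectorField p
  subst hσ0
  have hdoc : ∀ τ, σ τ ∈ 𝓑.doc := fun τ ↦ StationaryAFBlackHole.mem_doc_of_isMIntegralCurve hσ hp τ
  have hnull : ∀ τ, 𝓑.metric.val (σ τ) (𝓑.killing (σ τ)) (𝓑.killing (σ τ)) = 0 := fun τ ↦ by
    rw [val_killing_self_of_isMIntegralCurve hσ τ]
    exact hlam
  have haccτ : ∀ τ, 𝓑.metric.leviCivita 𝓑.killing (σ τ) (𝓑.killing (σ τ)) = κ • 𝓑.killing (σ τ) :=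
    leviCivita_killing_self_of_isMIntegralCurve hσ hacc
  -- the reparametrisation `γ s = σ (log (κ s) / κ)` on `D = {s | 0 < κ s}`
  set c : ℝ → ℝ := fun s ↦ (κ * s)⁻¹ with hc_def
  set ϑ : ℝ → ℝ := fun s ↦ Real.log (κ * s) / κ with hϑ_def
  set γ : ℝ → 𝓑.carrier := fun s ↦ σ (ϑ s) with hγ_def
  set D : Set ℝ := {s | 0 < κ * s} with hD_def
  have hDopen : IsOpen D := isOpen_lt continuous_const (continuous_const.mul continuous_id)
  have hDord : D.OrdConnected := by
    refine ⟨fun a ha b hb x hx ↦ ?_⟩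
    simp only [hD_def, mem_setOf_eq] at ha hb ⊢
    rcases le_or_gt 0 κ with hk | hk
    · have := mul_le_mul_of_nonneg_left hx.1 hk
      linarith
    · have := mul_le_mul_of_nonpos_left hx.2 hk.le
      linarith
  have hD0 : ∀ s ∈ D, s ≠ 0 := by
    rintro s hs rfl
    simp [hD_def] at hs
  have hDκ : 1 / κ ∈ D := by
    simp only [hD_def, mem_setOf_eq, mul_one_div_cancel hκ]
    exact one_pos
  -- differentiability of the pieces at `s ≠ 0`
  have hϑ : ∀ s ≠ 0, HasDerivAt ϑ (c s) s := fun s hs ↦ hasDerivAt_log_mul_div hκ hs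
  have hϑm : ∀ s ≠ 0, MDifferentiableAt 𝓘(ℝ, ℝ) 𝓘(ℝ, ℝ) ϑ s := fun s hs ↦
    mdifferentiableAt_iff_differentiableAt.mpr (hϑ s hs).differentiableAt
  have hγm : ∀ s ≠ 0, MDifferentiableAt 𝓘(ℝ, ℝ) (𝓡 4) γ s := fun s hs ↦
    (hσ (ϑ s)).mdifferentiableAt.comp s (hϑm s hs)
  have hcd : ∀ s ≠ 0, HasDerivAt c (-κ / (κ * s) ^ 2) s := fun s hs ↦ hasDerivAt_inv_mul hκ hs
  -- the velocity of `γ`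
  have hvel : ∀ s ≠ 0, velocity (𝓡 4) γ s = c s • 𝓑.killing (γ s) := by
    intro s hs
    have hϑ' : HasMFDerivAt 𝓘(ℝ, ℝ) 𝓘(ℝ, ℝ) ϑ s (ContinuousLinearMap.toSpanSingleton ℝ (c s)) :=
      hasMFDerivAt_iff_hasFDerivAt.2 (hϑ s hs).hasFDerivAt
    have hcomp := (hσ (ϑ s)).comp s hϑ'
    show velocity (𝓡 4) (σ ∘ ϑ) s = c s • 𝓑.killing (σ (ϑ s))
    rw [velocity, hcomp.mfderiv]
    change ((1 : ℝ) • c s) • 𝓑.killing (σ (ϑ s)) = c s • 𝓑.killing (σ (ϑ s))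
    rw [one_smul]
  -- the section `T ∘ γ` along `γ` has a differentiable lift
  have hW : ∀ s ≠ 0, MDifferentiableAt 𝓘(ℝ, ℝ) (𝓡 4).tangent
      (fun s ↦ (TotalSpace.mk' E4 (γ s) (𝓑.killing (γ s)) : TangentBundle (𝓡 4) 𝓑.carrier)) s :=
    fun s hs ↦ (mdifferentiableAt_killing (γ s)).comp s (hγm s hs)
  -- the tangent lift of `γ` is differentiable at `s ≠ 0`
  have hlift : ∀ s ≠ 0, MDifferentiableAt 𝓘(ℝ, ℝ) (𝓡 4).tangent (tangentLift (𝓡 4) γ) s := by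
    intro s hs
    set e := trivializationAt E4 (TangentSpace (𝓡 4) : 𝓑.carrier → Type _) (γ s) with he_def
    have hev : ∀ᶠ s' in 𝓝 s, s' ≠ 0 := isOpen_ne.mem_nhds hs
    have hbase : ∀ᶠ s' in 𝓝 s, γ s' ∈ e.baseSet :=
      (hγm s hs).continuousAt.preimage_mem_nhds
        (e.open_baseSet.mem_nhds (FiberBundle.mem_baseSet_trivializationAt' (γ s)))
    -- the model: `s' ↦ (γ s', c s' • T (γ s'))`
    have hmodel : MDifferentiableAt 𝓘(ℝ, ℝ) (𝓡 4).tangent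
        (fun s' ↦ (TotalSpace.mk' E4 (γ s') (c s' • 𝓑.killing (γ s')) :
          TangentBundle (𝓡 4) 𝓑.carrier)) s := by
      have hWs := hW s hs
      rw [mdifferentiableAt_totalSpace] at hWs ⊢
      refine ⟨hγm s hs, ?_⟩
      have h2 : MDifferentiableAt 𝓘(ℝ, ℝ) 𝓘(ℝ, E4)
          (fun s' ↦ c s' • (e (TotalSpace.mk' E4 (γ s') (𝓑.killing (γ s')))).2) s := by
        have hc' : DifferentiableAt ℝ c s := (hcd s hs).differentiableAt
        have hw' : DifferentiableAt ℝ
            (fun s' ↦ (e (TotalSpace.mk' E4 (γ s') (𝓑.killing (γ s')))).2) s :=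
          mdifferentiableAt_iff_differentiableAt.mp hWs.2
        exact mdifferentiableAt_iff_differentiableAt.mpr (hc'.smul hw')
      refine h2.congr_of_eventuallyEq ?_
      filter_upwards [hbase] with s' hs'
      exact (e.linear ℝ hs').map_smul (c s') (𝓑.killing (γ s'))
    refine hmodel.congr_of_eventuallyEq ?_
    filter_upwards [hev] with s' hs'
    simp only [tangentLift, hvel s' hs']
  -- locality of `D/ds` in the field along `γ`
  have hcongr : ∀ {W W' : Π t : ℝ, TangentSpace (𝓡 4) (γ t)} {t₀ : ℝ},
      (∀ᶠ t in 𝓝 t₀, W' t = W t) →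
        covariantDerivAlong cov γ W' t₀ = covariantDerivAlong cov γ W t₀ := by
    intro W W' t₀ h
    simp only [covariantDerivAlong, covariantDerivAlongFrame]
    have h0 : W' t₀ = W t₀ := h.self_of_nhds
    congr 1
    · refine Finset.sum_congr rfl fun i _ ↦ ?_
      congr 1
      apply Filter.EventuallyEq.deriv_eq
      filter_upwards [h] with t ht
      rw [ht]
    · rw [h0]
  -- the geodesic equation at `s ≠ 0`
  have hgeq : ∀ s ≠ 0, covariantDerivAlong cov γ (fun t ↦ velocity (𝓡 4) γ t) s = 0 := by
    intro s hs
    have hev : ∀ᶠ s' in 𝓝 s, s' ≠ 0 := isOpen_ne.mem_nhds hs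
    have h1 : covariantDerivAlong cov γ (fun t ↦ velocity (𝓡 4) γ t) s =
        covariantDerivAlong cov γ (fun t ↦ c t • 𝓑.killing (γ t)) s :=
      hcongr (by filter_upwards [hev] with t ht using hvel t ht)
    have h2 := covariantDerivAlong_smul_holds cov (γ := γ) (W := fun t ↦ 𝓑.killing (γ t)) (f := c)
      (t₀ := s) (hcd s hs).differentiableAt (hW s hs)
    have h3 := covariantDerivAlong_comp_holds cov (γ := γ) (Y := 𝓑.killing) (t₀ := s) (hγm s hs)
      (mdifferentiableAt_killing (γ s))
    rw [h1, h2, h3, hvel s hs, map_smul, (hcd s hs).deriv]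
    change (-κ / (κ * s) ^ 2) • 𝓑.killing (γ s) +
        c s • c s • 𝓑.metric.leviCivita 𝓑.killing (σ (ϑ s)) (𝓑.killing (σ (ϑ s))) = 0
    rw [haccτ (ϑ s), smul_smul, smul_smul, ← add_smul]
    have : -κ / (κ * s) ^ 2 + c s * c s * κ = 0 := by
      simp only [hc_def]
      field_simp
      ring
    rw [this, zero_smul]
  have hgeo : IsGeodesicOn cov γ D :=
    ⟨fun s hs ↦ hlift s (hD0 s hs), fun s hs ↦ hgeq s (hD0 s hs)⟩
  -- MAXIMALITY: no geodesic extension through `s = 0`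
  have hmax : IsMaximalGeodesicOn cov γ D := by
    refine ⟨hDopen, hDord, hgeo, fun γ' s' hs'o hs'c hDs' hgeo' heq ↦ ?_⟩
    by_contra hne
    obtain ⟨s₁, hs₁, hs₁D⟩ : ∃ s₁ ∈ s', s₁ ∉ D := by
      by_contra h
      push Not at h
      exact hne (Subset.antisymm (fun x hx ↦ h x hx) hDs')
    -- `0 ∈ s'`
    have h0 : (0 : ℝ) ∈ s' := by
      apply hs'c.uIcc_subset hs₁ (hDs' hDκ)
      simp only [hD_def, mem_setOf_eq, not_lt] at hs₁D
      rw [Set.mem_uIcc]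
      rcases lt_or_gt_of_ne hκ with hk | hk
      · right
        refine ⟨(one_div_neg.2 hk).le, ?_⟩
        by_contra h
        have := mul_pos_of_neg_of_neg hk (lt_of_not_ge h)
        linarith
      · left
        refine ⟨?_, (one_div_pos.2 hk).le⟩
        by_contra h
        have := mul_pos hk (lt_of_not_ge h)
        linarith
    -- the closure of `D` contains `0`
    have hcl : (0 : ℝ) ∈ closure D := by
      rcases lt_or_gt_of_ne hκ with hk | hk
      · have hD' : D = Iio 0 := by
          ext s
          simp only [hD_def, mem_setOf_eq, mem_Iio]
          constructor
          · intro h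
            by_contra h'
            have := mul_nonpos_of_nonpos_of_nonneg hk.le (not_lt.mp h')
            linarith
          · intro h
            exact mul_pos_of_neg_of_neg hk h
        rw [hD', closure_Iio]
        exact self_mem_Iic
      · have hD' : D = Ioi 0 := by
          ext s
          simp only [hD_def, mem_setOf_eq, mem_Ioi]
          exact mul_pos_iff_of_pos_left hk
        rw [hD', closure_Ioi]
        exact self_mem_Ici
    haveI hbot : (𝓝[D] (0 : ℝ)).NeBot := mem_closure_iff_nhdsWithin_neBot.mp hcl
    -- limits along `𝓝[D] 0` of the tangent lift of the extension
    set q : 𝓑.carrier := γ' 0 with hq_def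
    set e := trivializationAt E4 (TangentSpace (𝓡 4) : 𝓑.carrier → Type _) q with he_def
    have hqe : q ∈ e.baseSet := FiberBundle.mem_baseSet_trivializationAt' q
    have hz : tangentLift (𝓡 4) γ' 0 ∈ e.source := by
      rw [e.mem_source]
      exact hqe
    have htend : Tendsto (tangentLift (𝓡 4) γ') (𝓝[D] 0) (𝓝 (tangentLift (𝓡 4) γ' 0)) :=
      ((hgeo'.1 0 h0).continuousAt.tendsto).mono_left nhdsWithin_le_nhds
    obtain ⟨hA, hB⟩ := (e.tendsto_nhds_iff hz).1 htend
    have hA' : Tendsto γ' (𝓝[D] 0) (𝓝 q) := by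
      simpa [Function.comp_def] using hA
    have hevD : ∀ᶠ s in 𝓝[D] 0, s ∈ D := eventually_mem_nhdsWithin
    have hevB : ∀ᶠ s in 𝓝[D] 0, γ' s ∈ e.baseSet := hA' (e.open_baseSet.mem_nhds hqe)
    -- (i) the section `T` along `γ'` tends to `T q`
    have hz' : (TotalSpace.mk' E4 q (𝓑.killing q) : TangentBundle (𝓡 4) 𝓑.carrier) ∈ e.source := by
      rw [e.mem_source]
      exact hqe
    have hsec : Tendsto (fun s ↦ (e (TotalSpace.mk' E4 (γ' s) (𝓑.killing (γ' s)))).2) (𝓝[D] 0)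
        (𝓝 (e (TotalSpace.mk' E4 q (𝓑.killing q))).2) := by
      have h1 : Tendsto (fun s ↦ (TotalSpace.mk' E4 (γ' s) (𝓑.killing (γ' s)) :
          TangentBundle (𝓡 4) 𝓑.carrier)) (𝓝[D] 0) (𝓝 (TotalSpace.mk' E4 q (𝓑.killing q))) :=
        (mdifferentiableAt_killing q).continuousAt.tendsto.comp hA'
      exact ((e.tendsto_nhds_iff hz').1 h1).2
    -- (ii) along `D` the same quantity is `(κ s) • (e (γ' s, γ̇' s)).2`, which tends to `0`
    have hEq : ∀ᶠ s in 𝓝[D] 0, (e (TotalSpace.mk' E4 (γ' s) (𝓑.killing (γ' s)))).2 =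
        (κ * s) • (e (tangentLift (𝓡 4) γ' s)).2 := by
      filter_upwards [hevD, hevB] with s hsD hsB
      have hs0 : s ≠ 0 := hD0 s hsD
      have hγγ' : γ s = γ' s := heq hsD
      have hloc : γ' =ᶠ[𝓝 s] γ :=
        Filter.eventuallyEq_of_mem (hDopen.mem_nhds hsD) fun x hx ↦ (heq hx).symm
      have hT : (TotalSpace.mk' E4 (γ' s) (𝓑.killing (γ' s)) : TangentBundle (𝓡 4) 𝓑.carrier) =
          TotalSpace.mk' E4 (γ s) ((κ * s) • velocity (𝓡 4) γ s) := by
        rw [hvel s hs0, smul_smul, mul_inv_cancel₀ (mul_ne_zero hκ hs0), one_smul, hγγ']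
      have hsB' : γ s ∈ e.baseSet := by rwa [hγγ']
      rw [hT, (e.linear ℝ hsB').map_smul, tangentLift_congr_of_eventuallyEq hloc]
      rfl
    have hlim0 : Tendsto (fun s : ℝ ↦ (κ * s) • (e (tangentLift (𝓡 4) γ' s)).2) (𝓝[D] 0)
        (𝓝 ((κ * 0) • (e (tangentLift (𝓡 4) γ' 0)).2)) :=
      ((((continuous_const.mul continuous_id).tendsto (0 : ℝ)).mono_left
        nhdsWithin_le_nhds).smul hB)
    rw [mul_zero, zero_smul] at hlim0
    have hTq0 : (e (TotalSpace.mk' E4 q (𝓑.killing q))).2 = 0 :=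
      tendsto_nhds_unique_of_eventuallyEq hsec hlim0 hEq
    have hTq : 𝓑.killing q = 0 := by
      rw [← (e.continuousLinearEquivAt ℝ q hqe).map_eq_zero_iff,
        Trivialization.continuousLinearEquivAt_apply]
      exact hTq0
    -- `q` lies on the horizon, hence in the collar
    have hqdoc : q ∉ 𝓑.doc := fun h ↦ hT0 q h hTq
    have hqcl : q ∈ closure 𝓑.doc :=
      mem_closure_of_tendsto hA' (hevD.mono fun s hs ↦ by
        rw [← heq hs]
        exact hdoc (ϑ s))
    have hqH : q ∈ 𝓑.horizon := by
      refine ⟨⟨closure_mono inter_subset_right hqcl, fun h ↦ hqdoc ⟨hpres q, interior_subset h⟩⟩,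
        hpres q⟩
    obtain ⟨s, hsD, hsU⟩ : ∃ s, s ∈ D ∧ γ' s ∈ U := (hevD.and (hA' (hU.mem_nhds (hHU hqH)))).exists
    -- contradiction: a `κ`-light point of the orbit inside `U ∩ doc`
    have hy : γ s ∈ U := by
      rw [heq hsD]
      exact hsU
    have hKy : MDifferentiableAt (𝓡 4) (𝓡 4).tangent
        (fun x ↦ (TotalSpace.mk' E4 x (K x) : TangentBundle (𝓡 4) 𝓑.carrier)) (γ s) :=
      (hKs.contMDiffAt (hU.mem_nhds hy)).mdifferentiableAt (by simp)
    exact leviCivita_self_ne_smul_of_collar hKy (hKill _ hy) (hcomm _ hy) (hKtime _ ⟨hy, hdoc _⟩)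
      (hnull _) (hT0 _ (hdoc _)) hκ (haccτ (ϑ s))
  -- the antecedent
  refine ⟨{σ 0}, isCompact_singleton, singleton_subset_iff.2 hp, γ, D, hmax, ⟨1 / κ, hDκ⟩,
    fun s hs ↦ ?_, fun s hs ↦ ⟨σ, hσ, rfl, ϑ s, rfl⟩⟩
  have hs0 : s ≠ 0 := hD0 s hs
  have hTs : 𝓑.killing (γ s) ≠ 0 := hT0 _ (hdoc _)
  refine ⟨?_, ?_, ?_⟩
  · rw [hvel s hs0]
    simp only [map_smul, FunLike.coe_smul, Pi.smul_apply, smul_eq_mul]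
    change c s * (c s * 𝓑.metric.val (σ (ϑ s)) (𝓑.killing (σ (ϑ s))) (𝓑.killing (σ (ϑ s)))) = 0
    rw [hnull (ϑ s), mul_zero, mul_zero]
  · rw [hvel s hs0]
    exact smul_ne_zero (inv_ne_zero (mul_ne_zero hκ hs0)) hTs
  · rw [hvel s hs0]
    simp only [map_smul, FunLike.coe_smul, Pi.smul_apply, smul_eq_mul]
    change c s * 𝓑.metric.val (σ (ϑ s)) (𝓑.killing (σ (ϑ s))) (𝓑.killing (σ (ϑ s))) = 0
    rw [hnull (ϑ s), mul_zero]

end Incomplete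

/-! ### Every light point of the d.o.c. inhabits the antecedent -/

section LightPoint

variable {𝓑 : StationaryAFBlackHole.{0}} [𝓑.metric.HasLeviCivita]

/-- **Every Killing light point of the d.o.c. inhabits the antecedent of `ErgoregionBombModT`.**
In the telescope of the crux (clauses used: every event lies in `I⁺(M_ext)`, `T ≠ 0` on the
d.o.c., the Killing–timelike collar `(U, K)` on `U ⊇ 𝓔⁺`), a point `p ∈ ⟨⟨M_ext⟩⟩` with
`g(T,T)(p) = 0` and `∇_T T = κ T` at `p` (any `κ`) yields a maximal null geodesic of zero energy
trapped modulo the stationary flow: the orbit itself if `κ = 0`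
(`hasZeroEnergyRayTrappedModFlow_of_hoveringLightPoint`), its logarithmic reparametrisation on a
half-line if `κ ≠ 0` (`hasZeroEnergyRayTrappedModFlow_of_incompleteLightPoint`).  Consequently the
crux as typed must produce a growing mode from a light line ALONE, and "no light point in the
d.o.c." (`NoDocLightPoints`, the residue of line `killing-light-points`) is implied by the
non-trapping hypothesis of the rigidity crux (`noDocLightPoints_of_nonTrapping`).
[cite: HawkingEllis1973, §9.3 p. 331] -/
theorem hasZeroEnergyRayTrappedModFlow_of_lightPoint
    (hpres : ∀ p : 𝓑.carrier, p ∈ 𝓑.metric.chronologicalFuture 𝓑.timeOrientation 𝓑.Mext)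
    (hT0 : ∀ p ∈ 𝓑.doc, 𝓑.killing p ≠ 0) {U : Set 𝓑.carrier}
    {K : Π x : 𝓑.carrier, TangentSpace (𝓡 4) x} (hU : IsOpen U) (hHU : 𝓑.horizon ⊆ U)
    (hKs : ContMDiffOn (𝓡 4) ((𝓡 4).prod 𝓘(ℝ, E4)) ((⊤ : ℕ∞) : WithTop ℕ∞)
      (fun x ↦ (TotalSpace.mk' E4 x (K x) : TangentBundle (𝓡 4) 𝓑.carrier)) U)
    (hKill : ∀ x ∈ U, ∀ v w : TangentSpace (𝓡 4) x,
      𝓑.metric.val x (𝓑.metric.leviCivita K x v) w + 𝓑.metric.val x v (𝓑.metric.leviCivita K x w) = 0)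
    (hcomm : ∀ x ∈ U, VectorField.mlieBracket (𝓡 4) 𝓑.killing K x = 0)
    (hKtime : ∀ x ∈ U ∩ 𝓑.doc, 𝓑.metric.val x (K x) (K x) < 0)
    {p : 𝓑.carrier} (hp : p ∈ 𝓑.doc) (hlam : 𝓑.metric.val p (𝓑.killing p) (𝓑.killing p) = 0)
    {κ : ℝ} (hacc : 𝓑.metric.leviCivita 𝓑.killing p (𝓑.killing p) = κ • 𝓑.killing p) :
    𝓑.HasZeroEnergyRayTrappedModFlow := by
  rcases eq_or_ne κ 0 with rfl | hκ
  · rw [zero_smul] at hacc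
    exact hasZeroEnergyRayTrappedModFlow_of_hoveringLightPoint hT0 hp hlam hacc
  · exact hasZeroEnergyRayTrappedModFlow_of_incompleteLightPoint hpres hT0 hU hHU hKs hKill hcomm
      hKtime hp hlam hκ hacc

/-- **The incomplete species inhabits the antecedent** —
`hasZeroEnergyRayTrappedModFlow_of_incompleteLightPoint` in closed `∀`-form (the registered sub-goal
`incompleteLightPoint_inhabits_antecedent` of crux stmt-FinalStateConjecture-17838: a certificate, not an
obligation of the skeleton; only the telescope clauses actually used are kept).
[cite: HawkingEllis1973, §9.3 p. 331] -/
theorem incompleteLightPoint_inhabits_antecedent :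
    ∀ (𝓑 : Literature.Geometry.Lorentzian.StationaryAFBlackHole.{0}) [𝓑.metric.HasLeviCivita], (∀ p : 𝓑.carrier, p ∈ 𝓑.metric.chronologicalFuture 𝓑.timeOrientation 𝓑.Mext) → (∀ p ∈ 𝓑.doc, 𝓑.killing p ≠ 0) → ∀ (U : Set 𝓑.carrier) (K : Π x : 𝓑.carrier, TangentSpace (𝓡 4) x), IsOpen U → 𝓑.horizon ⊆ U → ContMDiffOn (𝓡 4) ((𝓡 4).prod 𝓘(ℝ, Literature.Geometry.Lorentzian.E4)) ((⊤ : ℕ∞) : WithTop ℕ∞) (fun x ↦ (Bundle.TotalSpace.mk' Literature.Geometry.Lorentzian.E4 x (K x) : TangentBundle (𝓡 4) 𝓑.carrier)) U → (∀ x ∈ U, ∀ v w : TangentSpace (𝓡 4) x, 𝓑.metric.val x (𝓑.metric.leviCivita K x v) w + 𝓑.metric.val x v (𝓑.metric.leviCivita K x w) = 0) → (∀ x ∈ U, VectorField.mlieBracket (𝓡 4) 𝓑.killing K x = 0) → (∀ x ∈ U ∩ 𝓑.doc, 𝓑.metric.val x (K x) (K x) < 0) → ∀ p ∈ 𝓑.doc,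 𝓑.metric.val p (𝓑.killing p) (𝓑.killing p) = 0 → ∀ κ : ℝ, κ ≠ 0 → 𝓑.metric.leviCivita 𝓑.killing p (𝓑.killing p) = κ • 𝓑.killing p → 𝓑.HasZeroEnergyRayTrappedModFlow :=
  fun _ _ hpres hT0 _ _ hU hHU hKs hKill hcomm hKtime _ hp hlam _ hκ hacc ↦
    hasZeroEnergyRayTrappedModFlow_of_incompleteLightPoint hpres hT0 hU hHU hKs hKill hcomm hKtime hp hlam
      hκ hacc

end LightPoint

end Summit.FinalStateConjecture.FinalStateConjecture.Theorems.ErgoregionBombModT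

end
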